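import Literature.AlgebraicGeometry.GroupSchemes.AffineGroupSchemeSpecPoints
import Literature.RingTheory.Idempotents.PiAlgebraCharacters
import Mathlib.AlgebraicGeometry.Morphisms.Etale
import Mathlib.AlgebraicGeometry.Morphisms.Finite
import Mathlib.RingTheory.Etale.Pi
import HarnessLib

/-!
# The ideal of a finite SUBGROUP of points of an affine group scheme is a Hopf ideal; the closed subgroup scheme it cuts out is
# `Spec R^J`, finite étale, with points exactly the given ones

Layer `Literature/AlgebraicGeometry/GroupSchemes`, namespace `Literature.AlgebraicGeometry.GroupSchemes.AffineGroupScheme` (continues ★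
`AffineGroupSchemeHopfAlgebra` p844646, ★ `HopfIdealClosedSubgroup` p844710, ★ `AffineGroupSchemeSpecPoints`).  THEOREMS ONLY (no definition, no
instance, no notation, no named fact, no `sorry`).  Cell `hodgecm-mathlib` (D-0151), programme P6 «MOD», sub-line
`Cruxes/HLiu418/Lines/F0_P6b_ConnectedEtale.lean`, stub `stub_b4g_etaleClosureOfGenericSubgroup_henselian` strategy σ2 «SECTIONS FIRST» (desk
F0P6b-plan (g0) 13:42:14Z ∕ 13:52:10Z; hand B-p12 (g30); twin σ1 F0P6-p10 (g0) yielded 13:52:09Z): brick (F2′) — the étale closure `C̄` of a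
finite subgroup `C` of sections, in ALGEBRA currency.  HONEST LABEL: HC_CM is proved only modulo the printed citations (hLiu418, h413) until
rung 0 closes; this file is count-neutral Mathlib-side capital.

THE MATHEMATICS ([GortzWedhorn2023] §(27.2) p. 607 «closed subgroup schemes of `Spec A` ↔ Hopf ideals»; [Tate1997FiniteFlatGroupSchemes] (3.7);
[StacksProject] Tag 04GG).  `G` an AFFINE group object of `SchemeOver R` with Hopf algebra `A = Alg G` (★ GAP-1), `u : J → G(Spec R)` a FINITE
family of `R`-points CLOSED under the group law (`1`, products, inverses up to reindexing), `φᵢ := ptEquiv G R (uᵢ) : A →ₐ[R] R` their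
algebra maps and `π := (φᵢ)ᵢ : A →ₐ[R] R^J` the evaluation map, ASSUMED SURJECTIVE (e.g. `R` local and the `uᵢ` with pairwise distinct
closed points — ★ `RingTheory/Ideal/ComaximalKernelsOfLocalSections.surjective_pi_of_pairwise_comap_maximalIdeal_ne`, CRT).  Let `I := ker π`.
* §1 `I` IS A HOPF IDEAL (`isHopfIdeal_ker_pi`): the counit is `φ` of the unit point (★ `one_eq`), so `ε(I) = 0`; the character `φᵢ ⊗ φⱼ` of
  `A ⊗ A` reads `Δ x` as `(φᵢ ⋆ φⱼ)(x) = φ_{uᵢuⱼ}(x)` (★ `mul_eq`, ★ `groupLaw_mul_apply`), which vanishes for `x ∈ I`, and these characters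
  kill-test `(A ⧸ I) ⊗ (A ⧸ I) ≅ R^J ⊗ R^J` (★ `Idempotents/PiAlgebraCharacters.map_mk_eq_zero_of_forall_lift_eq_zero`), so `Δ(I) ⊆ I ⊗ A + A ⊗ I`;
  `φᵢ ∘ S = φ_{uᵢ⁻¹}` (★ `inv_eq`, ★ `groupLaw_inv_apply`), so `S(I) ⊆ I`.
* §2 POINTS (`R` LOCAL): an `R`-point of `G` factors through `Spec (A ⧸ I) ↪ G` iff its algebra map kills `I` (★ `exists_comp_quotIncl_eq_iff_le_ker`)
  iff it IS one of the `uᵢ` (★ `PiAlgebraCharacters.exists_eq_of_ker_pi_le_ker`: characters of `R^J` over a local ring are evaluations).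
* §3 `Spec (A ⧸ I) → Spec R` is FINITE and ÉTALE (`A ⧸ I ≅ R^J`, Mathlib `Algebra.Etale` of finite products, `IsFinite.SpecMap_iff`, `HasRingHomProperty.Spec_iff`).
* §4 HEAD `exists_etale_closedSubgroup_of_points`: with ★ `exists_grpObj_isMonHom_quotIncl` — a closed subgroup scheme `c : C̄ ↪ G`, homomorphic
  closed immersion, `C̄ → Spec R` finite étale, whose `R`-points are exactly the `uᵢ`.

## References
* [GortzWedhorn2023] U. Görtz, T. Wedhorn, *Algebraic Geometry II* (2023), §(27.2) (27.2.1), p. 607 (closed subgroup schemes ↔ Hopf ideals).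
* [Tate1997FiniteFlatGroupSchemes] J. Tate, *Finite flat group schemes* (1997), (3.7) (the étale part; sections over a henselian base).
* [StacksProject] The Stacks Project, Tag 04GG (finite algebras over henselian local rings).
-/

set_option autoImplicit false

-- Mathlib's `Over`/`Scheme` APIs are stated across semireducible wrappers (as in the ★ `GroupSchemes/*` files).
set_option backward.isDefEq.respectTransparency false

universe u v

open CategoryTheory CategoryTheory.Limits AlgebraicGeometry MonoidalCategory CartesianMonoidalCategory TensorProduct

namespace Literature.AlgebraicGeometry.GroupSchemes

namespace AffineGroupScheme

open scoped MonObj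

open Literature.AlgebraicGeometry.Motives Literature.NumberTheory.DiophantineGeometry Literature.RingTheory.Idempotents

variable {R : Type u} [CommRing R] (G : SchemeOver R) [IsAffine G.left] {J : Type v} (u : J → (specOver R R ⟶ G))

/-! ## §0 The evaluation ideal `ker (φ_{uᵢ})ᵢ` -/

/-- Membership in the evaluation ideal: `a ∈ ker (φᵢ)ᵢ ↔ ∀ i, φᵢ a = 0`. [cite: GortzWedhorn2023, §(27.2) (p. 607)] -/
theorem mem_ker_pi_ptEquiv_iff (a : Alg G) :
    a ∈ RingHom.ker (AlgHom.pi fun i => ptEquiv G R (u i) : Alg G →ₐ[R] (J → R)).toRingHom ↔ ∀ i, ptEquiv G R (u i) a = 0 := by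
  rw [RingHom.mem_ker, AlgHom.toRingHom_eq_coe, AlgHom.coe_toRingHom]
  exact ⟨fun h i => by have := congr_fun h i; rwa [AlgHom.pi_apply] at this, fun h => funext fun i => by rw [AlgHom.pi_apply]; exact h i⟩

/-- The evaluation ideal is killed by each `φᵢ`. [cite: GortzWedhorn2023, §(27.2) (p. 607)] -/
theorem ker_pi_le_ker_ptEquiv (i : J) :
    RingHom.ker (AlgHom.pi fun i => ptEquiv G R (u i) : Alg G →ₐ[R] (J → R)).toRingHom ≤ RingHom.ker (ptEquiv G R (u i)).toRingHom :=
  fun _ ha => ((mem_ker_pi_ptEquiv_iff G u _).1 ha) i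

/-! ## §1 The ideal of a finite subgroup of points is a Hopf ideal -/

/-- **THE IDEAL OF A FINITE SUBGROUP OF POINTS IS A HOPF IDEAL.**  For an affine group object `G` of `SchemeOver R`, a finite family
`u : J → G(Spec R)` containing `1` and closed under products and inverses (up to reindexing), whose evaluation map `π = (ptEquiv (uᵢ))ᵢ :
Γ(G) → R^J` is surjective, `ker π` is a Hopf ideal of the Hopf algebra `Γ(G)` (Mathlib `Ideal.IsHopfIdeal`): `ε` is `φ` of the unit point;
`(φᵢ ⊗ φⱼ)(Δx) = φ_{uᵢuⱼ}(x) = 0` and the `φᵢ ⊗ φⱼ` kill-test `(Γ(G)⧸ker π)^{⊗2} ≅ (R^J)^{⊗2}`; `φᵢ ∘ S = φ_{uᵢ⁻¹}`.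
[cite: GortzWedhorn2023, §(27.2) (27.2.1) (p. 607)] [cite: Tate1997FiniteFlatGroupSchemes, (3.7)] -/
theorem isHopfIdeal_ker_pi [GrpObj G] [Finite J] (hπ : Function.Surjective (AlgHom.pi fun i => ptEquiv G R (u i) : Alg G →ₐ[R] (J → R)))
    (hone : ∃ i, u i = 1) (hmul : ∀ i j, ∃ k, u k = u i * u j) (hinv : ∀ i, ∃ k, u k = (u i)⁻¹) :
    (RingHom.ker (AlgHom.pi fun i => ptEquiv G R (u i) : Alg G →ₐ[R] (J → R)).toRingHom).IsHopfIdeal R := by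
  have hmem : ∀ {a : Alg G}, a ∈ RingHom.ker (AlgHom.pi fun i => ptEquiv G R (u i) : Alg G →ₐ[R] (J → R)).toRingHom ↔
      ∀ i, ptEquiv G R (u i) a = 0 := fun {a} => mem_ker_pi_ptEquiv_iff G u a
  have hco : ((RingHom.ker (AlgHom.pi fun i => ptEquiv G R (u i) : Alg G →ₐ[R] (J → R)).toRingHom).restrictScalars R).IsCoideal :=
    { counit_eq_zero := fun a ha => by
        rw [Submodule.restrictScalars_mem] at ha
        obtain ⟨i₀, hi₀⟩ := hone
        have h := (hmem.1 ha) i₀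
        rw [hi₀, ← groupLaw_one, (groupLaw G).one_eq, AlgHom.comp_apply, Algebra.ofId_apply, Algebra.algebraMap_self, RingHom.id_apply] at h
        exact h
      map_mkQ_comul_eq_zero := fun a ha => by
        rw [Submodule.restrictScalars_mem] at ha
        have key : ∀ i j, Algebra.TensorProduct.lift (ptEquiv G R (u i)) (ptEquiv G R (u j)) (fun _ _ => .all _ _) ((groupLaw G).comul a) = 0 := by
          intro i j
          obtain ⟨k, hk⟩ := hmul i j
          rw [← AlgHom.comp_apply, ← (groupLaw G).mul_eq, groupLaw_mul_apply, ← hk]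
          exact (hmem.1 ha) k
        exact map_mk_eq_zero_of_forall_lift_eq_zero (fun i => ptEquiv G R (u i)) hπ _ key }
  refine { toIsCoideal := hco, antipode_mem := fun a ha => ?_ }
  refine hmem.2 fun i => ?_
  obtain ⟨k, hk⟩ := hinv i
  have h : ptEquiv G R (u i) ((groupLaw G).antipodeAlgHom a) = 0 := by
    rw [← AlgHom.comp_apply, ← (groupLaw G).inv_eq, groupLaw_inv_apply, ← hk]
    exact (hmem.1 ha) k
  exact h

/-! ## §2 Over a local base the points of `Spec (Γ(G) ⧸ ker π) ↪ G` are exactly the `uᵢ` -/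

/-- **An `R`-point killing `ker π` is one of the `uᵢ`** (`R` LOCAL, `π` surjective): its algebra map is a character of `Γ(G) ⧸ ker π ≅ R^J`,
i.e. an evaluation (★ `PiAlgebraCharacters.exists_eq_of_ker_pi_le_ker`), and `ptEquiv` is injective. [cite: StacksProject, Tag 04GG] -/
theorem exists_eq_of_ker_pi_le_ker_ptEquiv [IsLocalRing R] [Finite J]
    (hπ : Function.Surjective (AlgHom.pi fun i => ptEquiv G R (u i) : Alg G →ₐ[R] (J → R))) (w : specOver R R ⟶ G)
    (hw : RingHom.ker (AlgHom.pi fun i => ptEquiv G R (u i) : Alg G →ₐ[R] (J → R)).toRingHom ≤ RingHom.ker (ptEquiv G R w).toRingHom) :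
    ∃ i, w = u i := by
  obtain ⟨i, hi⟩ := exists_eq_of_ker_pi_le_ker (fun i => ptEquiv G R (u i)) hπ (ptEquiv G R w) hw
  exact ⟨i, (ptEquiv G R).injective hi⟩

/-- **POINTS OF THE CLOSED SUBSCHEME `Spec (Γ(G) ⧸ ker π) ↪ G` OVER A LOCAL BASE ARE EXACTLY THE `uᵢ`** (★ `exists_comp_quotIncl_eq_iff_le_ker`
+ §2). [cite: GortzWedhorn2023, (27.1.1) and §(27.2) (p. 607)] [cite: StacksProject, Tag 04GG] -/
theorem exists_comp_quotIncl_ker_pi_iff [IsLocalRing R] [Finite J]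
    (hπ : Function.Surjective (AlgHom.pi fun i => ptEquiv G R (u i) : Alg G →ₐ[R] (J → R))) (w : specOver R R ⟶ G) :
    (∃ x : specOver R R ⟶ specOver R (Alg G ⧸ RingHom.ker (AlgHom.pi fun i => ptEquiv G R (u i) : Alg G →ₐ[R] (J → R)).toRingHom),
        x ≫ quotIncl G (RingHom.ker (AlgHom.pi fun i => ptEquiv G R (u i) : Alg G →ₐ[R] (J → R)).toRingHom) = w) ↔ ∃ i, w = u i := by
  rw [exists_comp_quotIncl_eq_iff_le_ker]
  constructor
  · exact exists_eq_of_ker_pi_le_ker_ptEquiv G u hπ w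
  · rintro ⟨i, rfl⟩
    exact ker_pi_le_ker_ptEquiv G u i

/-! ## §3 `Spec (A ⧸ ker π) → Spec R` is finite étale -/

section FiniteEtale

variable {A : Type u} [CommRing A] [Algebra R A] (π : A →ₐ[R] (J → R))

/-- `A ⧸ ker π ≅ R^J` is a FINITE `R`-module when `π : A → R^J` is surjective (`J` finite). [cite: StacksProject, Tag 04GG] -/
theorem moduleFinite_quotient_ker_of_surjective [Finite J] (hπ : Function.Surjective π) : Module.Finite R (A ⧸ RingHom.ker π.toRingHom) :=
  Module.Finite.equiv (Ideal.quotientKerAlgEquivOfSurjective hπ).symm.toLinearEquiv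

/-- `A ⧸ ker π ≅ R^J` is an ÉTALE `R`-algebra when `π : A → R^J` is surjective (`J` finite; Mathlib: finite products of étale algebras).
[cite: StacksProject, Tag 04GG] -/
theorem etale_quotient_ker_of_surjective [Finite J] (hπ : Function.Surjective π) : Algebra.Etale R (A ⧸ RingHom.ker π.toRingHom) :=
  Algebra.Etale.of_equiv (Ideal.quotientKerAlgEquivOfSurjective hπ).symm

/-- **`Spec (A ⧸ ker π) → Spec R` is FINITE** (`π : A ↠ R^J`, `J` finite). [cite: StacksProject, Tag 04GG] -/
theorem isFinite_specOver_quotient_ker_hom [Finite J] (hπ : Function.Surjective π) : IsFinite (specOver R (A ⧸ RingHom.ker π.toRingHom)).hom := by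
  haveI := moduleFinite_quotient_ker_of_surjective π hπ
  change IsFinite (Spec.map (CommRingCat.ofHom (algebraMap R (A ⧸ RingHom.ker π.toRingHom))))
  rw [IsFinite.SpecMap_iff, CommRingCat.hom_ofHom, RingHom.finite_algebraMap]
  infer_instance

/-- **`Spec (A ⧸ ker π) → Spec R` is ÉTALE** (`π : A ↠ R^J`, `J` finite). [cite: StacksProject, Tag 04GG] -/
theorem etale_specOver_quotient_ker_hom [Finite J] (hπ : Function.Surjective π) : Etale (specOver R (A ⧸ RingHom.ker π.toRingHom)).hom := by
  haveI := etale_quotient_ker_of_surjective π hπ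
  change Etale (Spec.map (CommRingCat.ofHom (algebraMap R (A ⧸ RingHom.ker π.toRingHom))))
  rw [HasRingHomProperty.Spec_iff (P := @Etale), CommRingCat.hom_ofHom, RingHom.etale_algebraMap]
  infer_instance

end FiniteEtale

/-! ## §4 HEAD: the finite étale closed subgroup scheme through a finite subgroup of points -/

/-- **THE ÉTALE CLOSED SUBGROUP SCHEME THROUGH A FINITE SUBGROUP OF POINTS.**  `R` LOCAL, `G` an affine group object of `SchemeOver R`,
`u : J → G(Spec R)` a finite family containing `1` and closed under products and inverses, whose evaluation map `Γ(G) → R^J` is surjective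
(pairwise distinct closed points, CRT).  THEN `C̄ := Spec (Γ(G) ⧸ ker π)` carries a group-scheme structure with a HOMOMORPHIC CLOSED IMMERSION
`c : C̄ ↪ G` (★ `exists_grpObj_isMonHom_quotIncl`, §1), `C̄ → Spec R` is FINITE ÉTALE (§3, `≅ ∐_J Spec R`), and the `R`-points of `G` through
`c` are EXACTLY the `uᵢ` (§2).  [cite: GortzWedhorn2023, §(27.2) (27.2.1) (p. 607)] [cite: Tate1997FiniteFlatGroupSchemes, (3.7)] [cite: StacksProject, Tag 04GG] -/
theorem exists_etale_closedSubgroup_of_points [GrpObj G] [IsLocalRing R] [Finite J]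
    (hπ : Function.Surjective (AlgHom.pi fun i => ptEquiv G R (u i) : Alg G →ₐ[R] (J → R)))
    (hone : ∃ i, u i = 1) (hmul : ∀ i j, ∃ k, u k = u i * u j) (hinv : ∀ i, ∃ k, u k = (u i)⁻¹) :
    ∃ (H : SchemeOver R) (_ : GrpObj H) (c : H ⟶ G),
      IsMonHom c ∧ IsClosedImmersion c.left ∧ IsFinite H.hom ∧ Etale H.hom ∧
        ∀ w : specOver R R ⟶ G, (∃ x : specOver R R ⟶ H, x ≫ c = w) ↔ ∃ i, w = u i := by
  haveI := isHopfIdeal_ker_pi G u hπ hone hmul hinv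
  obtain ⟨GZ, hhom⟩ := exists_grpObj_isMonHom_quotIncl G
    (RingHom.ker (AlgHom.pi fun i => ptEquiv G R (u i) : Alg G →ₐ[R] (J → R)).toRingHom)
  exact ⟨_, GZ, quotIncl G _, hhom, isClosedImmersion_quotIncl_left G _, isFinite_specOver_quotient_ker_hom _ hπ,
    etale_specOver_quotient_ker_hom _ hπ, fun w => exists_comp_quotIncl_ker_pi_iff G u hπ w⟩

end AffineGroupScheme

end Literature.AlgebraicGeometry.GroupSchemes
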